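import Literature.Topology.FourManifolds.LinkKhResolutions
import Literature.Topology.FourManifolds.KhComplex
import Literature.Topology.FourManifolds.KhFaces
import Mathlib.Algebra.Homology.HomologicalComplex
import Mathlib.Algebra.Homology.ShortComplex.ModuleCat
import Mathlib.Algebra.Category.ModuleCat.Basic
import Mathlib.Algebra.Module.Equiv.Basic
import Mathlib.LinearAlgebra.Matrix.ToLin
import Mathlib.LinearAlgebra.Quotient.Basic
import Mathlib.Data.Fintype.BigOperators
import Mathlib.Order.WithBot
import HarnessLib

/-!
# The Khovanov complex of a link Gauss diagram (link tower, layer D2b: enhanced states and `d`)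

Third file of the link tower `LinkGaussDiagrams` (D1: `LinkGaussDiagram`, `ofGaussDiagram`, `Arc`,
`unknots`, Morse moves) → `LinkKhResolutions` (D2a: the cube `State`, `stateGraph`, `StateCircle`,
`circleOf`, `IsMergeAt`, `IsSplitAt`, and the correspondence `arcEquiv`, `stateGraphIso`,
`circleOf_ofGaussDiagram_eq_iff` with the knot tower) → **this file**, which ports the knot
tower's `KhComplex` (`GaussDiagram.EnhancedState`, `homDegree`, `qDegree`, `edgeSign`, `incidence`,
`degStates`, `bidegStates`, `khovanovD`, `khovanovD_eq_zero_of_ne`, `frobeniusHomology`,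
`frobeniusComplex`, `khovanovDQ`, `khovanovHomology`) and the *definitions* of `LeeRasmussen`
(`leeD`, `leeComplex`, `leeHomology`, `LeeHomologyZero`, `leeCycles`, `qMin`, `classDegree`,
`leeSMin`, `leeSMax`, `rasmussenInvariant`) to Gauss diagrams of oriented LINKS (census of crux
`ZseThesis`, stmt-SmoothPoincare4-0364, debt (D2)).

## The design rule (as in D2a)

EVERY definition is the knot tower's, with the arcs `L.Arc = Fin (2n) ⊕ Fin free` and the cube
notions of `LinkKhResolutions` substituted, and NOTHING else changed: an enhanced state is a state
with a labelling `L.Arc → Bool` (`1 ↔ false`, `X ↔ true`, the basis of `A = R[X]/(X² - hX - t)`)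
constant along state circles (a free circle is a state circle on its own and carries its own
label); `homDegree s = |s| - n₋`, `qDegree s = #(circles labelled 1) - #(circles labelled X) + |s|
+ n₊ - 2 n₋`, `edgeSign σ i = (-1) ^ #{j < i | σ j = 1}`; `incidence R h t s s'` has the knot
tower's three clauses (merge at the flipped chord / split / neither ↦ `0`) with the agreement of
labels off the changed circle, the tables `GaussDiagram.mergeCoeff/splitCoeff` of `KhComplex`
(equivalently `KhFace.mergeInc/splitInc` of `KhFaces`: `incidence_eq_mergeInc`,
`incidence_eq_splitInc`) and the sign `edgeSign`; `khovanovD R h t i i'` is the incidence matrix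
between `degStates i` and `degStates i'` (`Matrix.toLin'`, cast-free); `frobeniusHomology =
ker dᵢ ⧸ (im dᵢ₋₁ ⊓ ker dᵢ)`; the bigraded integral `khovanovDQ`, `khovanovHomology`; Lee's
specialisation `(ℚ, 0, 1)` and Rasmussen's filtration data — all verbatim.

`d² = 0`: in the knot tower this is the named fact `GaussDiagram.khovanovD_comp_khovanovD`
(hypothesis `hd` of `GaussDiagram.frobeniusComplex`). This file states NO new named fact:
`frobeniusComplex` and `leeComplex` take the `d² = 0` identity of the given diagram as an explicit
hypothesis `hd`; everything else is total and unconditional.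

## Agreement with the knot tower (`G.n ≠ 0`)

Along `arcEquiv G hG : (ofGaussDiagram G).Arc ≃ G.Arc` of D2a: enhanced states correspond
(`enhancedStateEquiv`, labels transported along `arcEquiv`), preserving `homDegree`
(`homDegree_enhancedStateEquiv`, `rfl`) and `qDegree` (`qDegree_enhancedStateEquiv`); incidence
numbers agree (`incidence_enhancedStateEquiv`: merges, splits, circles and the local strands
`arcIn/arcOut (overPos i)` correspond); hence the differentials are conjugate under the relabelling
of bases (`degStatesEquiv`, `bidegStatesEquiv`, `khovanovD_comp_funCongrLeft`,
`khovanovDQ_comp_funCongrLeft`) and the homologies are isomorphic (`frobeniusHomologyIso`,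
`khovanovHomologyIso`, by the transport lemma `subquotientEquivOfConj`). The `n = 0` caveat of D2a
persists: the crossingless unknot diagram of the link tower is `unknots 1`, not
`ofGaussDiagram GaussDiagram.empty = unknots 0`; its data are computed by hand below and match the
knot tower's `GaussDiagram.leeSMax_empty = 1`, `GaussDiagram.rasmussenInvariant_empty = 0`.

Sanity (`unknots k`, the crossingless `k`-component unlink): `homDegree = 0`
(`homDegree_unknots`), enhanced states = labellings of the `k` free circles
(`card_enhancedState_unknots : # = 2 ^ k`), `qDegree = #(labels 1) - #(labels X) ∈ [-k, k]`
(`qDegree_unknots`), `s_max (unknots k) = k` (`leeSMax_unknots`),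
`rasmussenInvariant (unknots 1) = 0` (`rasmussenInvariant_unknots_one`).

Not here (next layers): `d² = 0` for realisable link diagrams (port of `KhComplexFaceProofs` via
`incidence_eq_mergeInc/splitInc` and `KhFace.face_comm`), the comparison of `frobeniusHomology`
with the categorical homology of `frobeniusComplex`, invariance, Lee's `2^m` theorem, and the chain
maps of the Morse moves (Rasmussen (2010), §4).

## References

* M. Khovanov, *A categorification of the Jones polynomial*, Duke Math. J. 101 (2000) 359–426,
  §4 (cube, §4.2 enhanced generators), §5 (the differential), §7, Prop. 8.
  [cite: Khovanov2000, §4–5]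
* D. Bar-Natan, *On Khovanov's categorification of the Jones polynomial*, Algebr. Geom. Topol. 2
  (2002) 337–370, §3 (§3.1 cube, §3.2 gradings and signs; unknot, unlinks). [cite: BarNatan2002, §3]
* M. Khovanov, *Link homology and Frobenius extensions*, Fund. Math. 190 (2006) 179–190, §2
  (the universal rank-two system `X² = hX + t`). [cite: Khovanov2006, §2]
* O. Viro, *Khovanov homology, its definitions and ramifications*, Fund. Math. 184 (2004)
  317–342, §5 (enhanced states, §5.2 incidence numbers). [cite: Viro2004, §5]
* E. S. Lee, *An endomorphism of the Khovanov invariant*, Adv. Math. 197 (2005) 554–586, §4.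
  [cite: Lee2005, §4]
* J. Rasmussen, *Khovanov homology and the slice genus*, Invent. Math. 182 (2010) 419–447, §2
  (Lee's theory, the filtration `s`), Def. 3.1, Def. 3.4. [cite: Rasmussen2010, §2]
* Mathlib: `Matrix.toLin'`, `Matrix.of`, `LinearMap.ker/range`, `Submodule.comap`,
  `Submodule.Quotient.equiv`, `LinearEquiv.ofSubmodules`, `LinearEquiv.funCongrLeft`,
  `LinearEquiv.toModuleIso`, `CochainComplex.of`, `SimpleGraph.Iso.connectedComponentEquiv`,
  `Finset.card_equiv`, `Fintype.sum_equiv`, `WithBot`/`WithTop`.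
-/

open Function Set CategoryTheory

noncomputable section

namespace Literature.Topology.FourManifolds

namespace LinkGaussDiagram

variable (L : LinkGaussDiagram)

/-! ## Enhanced states and gradings (verbatim from the knot tower) -/

/-- An **enhanced state** of a link Gauss diagram (Viro (2004), §5; Khovanov (2000), §4.2: a
generator of the cube complex): a state `state` (complete resolution) with a labelling of its state
circles by the basis `{1 ↔ false, X ↔ true}` of the Frobenius algebra, recorded as a function
`label` on the arcs `L.Arc = Fin (2n) ⊕ Fin free` constant along state circles (`label_eq`: equal
on adjacent arcs of the state graph, hence on connected components; a free circle is adjacent to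
nothing and carries its own label). Verbatim `GaussDiagram.EnhancedState`. [cite: Viro2004, §5] -/
structure EnhancedState where
  /-- The underlying state (complete resolution). -/
  state : L.State
  /-- The label `1 ↔ false`, `X ↔ true` of the state circle through each arc. -/
  label : L.Arc → Bool
  /-- Labels are constant along state circles. -/
  label_eq : ∀ a b, (L.stateGraph state).Adj a b → label a = label b

variable {L} in
/-- Two enhanced states with the same state and the same labelling are equal. [folklore] -/
theorem EnhancedState.ext' {s t : L.EnhancedState} (h₁ : s.state = t.state)
    (h₂ : s.label = t.label) : s = t := by
  cases s; cases t; cases h₁; cases h₂; rfl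

variable {L} in
/-- Labels of an enhanced state are constant on state circles: arcs on the same state circle carry
the same label (from `label_eq` along a walk). Viro (2004), §5.1. [cite: Viro2004, §5] -/
theorem EnhancedState.label_eq_of_circleOf_eq (s : L.EnhancedState) {a b : L.Arc}
    (h : L.circleOf s.state a = L.circleOf s.state b) : s.label a = s.label b := by
  rw [circleOf, circleOf, SimpleGraph.ConnectedComponent.eq] at h
  obtain ⟨w⟩ := h
  induction w with
  | nil => rfl
  | cons hadj _ ih => exact (s.label_eq _ _ hadj).trans ih

/-- Enhanced states form a finite type (injection into `State × (Arc → Bool)`). Khovanov (2000),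
§4.2 (the cube complex is finitely generated). [cite: Khovanov2000, §4.2] -/
instance EnhancedState.instFintype : Fintype L.EnhancedState :=
  Fintype.ofInjective (fun s ↦ (s.state, s.label)) (fun s t h ↦ by
    simp only [Prod.mk.injEq] at h
    exact EnhancedState.ext' h.1 h.2)

/-- Equality of enhanced states is decidable (equality of the state and of the labelling).
[folklore] -/
instance EnhancedState.instDecidableEq : DecidableEq L.EnhancedState := fun s t ↦
  decidable_of_iff (s.state = t.state ∧ s.label = t.label)
    ⟨fun h ↦ EnhancedState.ext' h.1 h.2, fun h ↦ by subst h; exact ⟨rfl, rfl⟩⟩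

variable {L} in
/-- The **homological degree** of an enhanced state: `i(s) = |s| - n₋` (weight of the state minus
the number of negative crossings), verbatim `GaussDiagram.homDegree`. Bar-Natan (2002), §3.2;
Rasmussen (2010), §2. [cite: BarNatan2002, §3.2] -/
def homDegree (s : L.EnhancedState) : ℤ := (s.state.weight : ℤ) - L.nMinus

variable {L} in
/-- The **quantum degree** of an enhanced state:
`j(s) = #(circles labelled 1) - #(circles labelled X) + |s| + n₊ - 2 n₋` (a circle is labelled `1`,
resp. `X`, if some arc on it has label `false`, resp. `true`; by `label_eq` exactly one holds),
verbatim `GaussDiagram.qDegree`; free circles count like all circles (Khovanov (2000), §4.2: a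
crossingless component is a tensor factor `A`), so the crossingless unknot `unknots 1` has its two
generators in bidegrees `(0, ±1)`. Bar-Natan (2002), §3.2; Viro (2004), §5.1.
[cite: BarNatan2002, §3.2] -/
def qDegree (s : L.EnhancedState) : ℤ :=
  ((Finset.univ.filter fun c : L.StateCircle s.state ↦
      ∃ a, L.circleOf s.state a = c ∧ s.label a = false).card : ℤ) -
  ((Finset.univ.filter fun c : L.StateCircle s.state ↦
      ∃ a, L.circleOf s.state a = c ∧ s.label a = true).card : ℤ) +
  s.state.weight + L.nPlus - 2 * L.nMinus

variable {L} in
/-- The **Koszul sign** of the edge `σ → σ[i ↦ 1]` of the cube of resolutions: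
`(-1) ^ #{j < i | σ j = 1}`, verbatim `GaussDiagram.edgeSign` (which reads only the state, a
function `Fin n → Bool`). Khovanov (2000), §3.3; Bar-Natan (2002), §3.2.
[cite: Khovanov2000, §3.3] -/
def edgeSign (σ : L.State) (i : Fin L.n) : ℤ :=
  (-1) ^ (Finset.univ.filter fun j ↦ j < i ∧ σ j = true).card

/-- On the image of a knot diagram the Koszul sign is the knot tower's (definitionally: same states,
same formula). [folklore] -/
@[simp]
theorem edgeSign_ofGaussDiagram (G : GaussDiagram) (σ : G.State) (i : Fin G.n) :
    edgeSign (L := ofGaussDiagram G) σ i = GaussDiagram.edgeSign σ i := rfl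

/-! ## Incidence numbers and the differential (verbatim from the knot tower) -/

section Ring

variable (R : Type) [CommRing R]

/-- The **incidence number** `⟨d s, s'⟩ ∈ R` of two enhanced states in the Khovanov complex over
`A = R[X]/(X² - hX - t)`, verbatim `GaussDiagram.incidence` (Viro (2004), §5.2; Khovanov (2000),
§4.2; Khovanov (2006), §2). It is zero unless `s'.state` is obtained from `s.state` by flipping a
single `0`-smoothing `i` to `1` (`s'.state = Function.update s.state i true`; such an `i` is
unique, `flip_unique`, and is extracted by `Classical.choose`). In that case, with
`a := arcIn (overPos i)` and `b := arcOut (overPos i)` the two local strands at chord `i`, there is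
the three-way case split of `LinkKhResolutions`:
* *merge* (`IsMergeAt`): the labels of `s` and `s'` must agree at every arc off the merged circle
  of `s'` (the circle of `a` in `s'.state`); the value is
  `edgeSign s.state i * mergeCoeff h t (s.label a) (s.label b) (s'.label a)`;
* *split* (`IsSplitAt`): the labels must agree at every arc off the split circle of `s` (the
  circle of `a` in `s.state`); the value is
  `edgeSign s.state i * splitCoeff h t (s.label a) (s'.label a) (s'.label b)`;
* *neither* (one-to-one bifurcation, virtual diagrams only; Viro (2004), §5): the value is `0`.
[cite: Viro2004, §5.2] -/
def incidence (h t : R) (s s' : L.EnhancedState) : R :=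
  if hi : ∃ i, s.state i = false ∧ s'.state = Function.update s.state i true then
    let i := Classical.choose hi
    let a := L.arcIn (L.overPos i)
    let b := L.arcOut (L.overPos i)
    if L.IsMergeAt s.state i then
      if ∀ c, L.circleOf s'.state c ≠ L.circleOf s'.state a → s'.label c = s.label c then
        (edgeSign s.state i : R) *
          GaussDiagram.mergeCoeff R h t (s.label a) (s.label b) (s'.label a)
      else 0
    else if L.IsSplitAt s.state i then
      if ∀ c, L.circleOf s.state c ≠ L.circleOf s.state a → s'.label c = s.label c then
        (edgeSign s.state i : R) *
          GaussDiagram.splitCoeff R h t (s.label a) (s'.label a) (s'.label b)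
      else 0
    else 0
  else 0

variable {L} in
/-- Flipping a `0`-smoothing to a `1`-smoothing raises the weight of a state by one.
Bar-Natan (2002), §3.1 (edges of the cube go up one level). [cite: BarNatan2002, §3.1] -/
theorem State.weight_update {σ : L.State} {i : Fin L.n} (hi : σ i = false) :
    State.weight (Function.update σ i true) = σ.weight + 1 := by
  unfold State.weight
  have h : (Finset.univ.filter fun j ↦ Function.update σ i true j = true) =
      insert i (Finset.univ.filter fun j ↦ σ j = true) := by
    ext j
    by_cases hj : j = i
    · subst hj; simp
    · simp [hj]
  rw [h, Finset.card_insert_of_notMem (by simp [hi])]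

variable {L} in
/-- The state reached by flipping a `0`-smoothing determines the flipped chord. [folklore] -/
theorem flip_unique {σ : L.State} {i j : Fin L.n} (hi : σ i = false)
    (h : Function.update σ j true = Function.update σ i true) : j = i := by
  by_contra hji
  have := congrFun h i
  rw [Function.update_of_ne (Ne.symm hji), Function.update_self, hi] at this
  exact Bool.false_ne_true this

variable {L} in
/-- **The incidence number of a flip, explicitly.** If `s'.state` is `s.state` with the
`0`-smoothing at chord `i` flipped to `1`, the incidence number `⟨d s, s'⟩` is given by the
merge/split/neither case split of `incidence` *at this chord `i`* (no choice involved,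
`flip_unique`). Viro (2004), §5.2. [cite: Viro2004, §5.2] -/
theorem incidence_of_flip (h t : R) {s s' : L.EnhancedState} {i : Fin L.n}
    (hi : s.state i = false) (hs' : s'.state = Function.update s.state i true) :
    L.incidence R h t s s' =
      if L.IsMergeAt s.state i then
        (if ∀ c, L.circleOf s'.state c ≠ L.circleOf s'.state (L.arcIn (L.overPos i)) →
            s'.label c = s.label c then
          (edgeSign s.state i : R) * GaussDiagram.mergeCoeff R h t (s.label (L.arcIn (L.overPos i)))
            (s.label (L.arcOut (L.overPos i))) (s'.label (L.arcIn (L.overPos i)))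
        else 0)
      else if L.IsSplitAt s.state i then
        (if ∀ c, L.circleOf s.state c ≠ L.circleOf s.state (L.arcIn (L.overPos i)) →
            s'.label c = s.label c then
          (edgeSign s.state i : R) * GaussDiagram.splitCoeff R h t (s.label (L.arcIn (L.overPos i)))
            (s'.label (L.arcIn (L.overPos i))) (s'.label (L.arcOut (L.overPos i)))
        else 0)
      else 0 := by
  have hex : ∃ j, s.state j = false ∧ s'.state = Function.update s.state j true := ⟨i, hi, hs'⟩
  unfold incidence
  rw [dif_pos hex]
  have hj : Classical.choose hex = i :=
    flip_unique hi ((Classical.choose_spec hex).2.symm.trans hs')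
  simp only [hj]

variable {L} in
/-- Without a single `0 → 1` flip relating the states, the incidence number vanishes.
[folklore] -/
theorem incidence_of_not_flip (h t : R) {s s' : L.EnhancedState}
    (hn : ¬ ∃ i, s.state i = false ∧ s'.state = Function.update s.state i true) :
    L.incidence R h t s s' = 0 := by
  unfold incidence
  rw [dif_neg hn]

variable {L} in
/-- **Merge edges through `KhFaces`.** Along a merge edge `s.state → s'.state = s.state[i ↦ 1]` the
incidence number is the Koszul sign times the abstract merge incidence `KhFace.mergeInc` of
`KhFaces` (circle map of the target state, the two labellings, the local strands), so that the
diagram-independent face algebra `KhFace.face_comm` applies to link diagrams as to knot diagrams.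
Viro (2004), §5.2; Khovanov (2000), Prop. 8. [cite: Viro2004, §5.2] -/
theorem incidence_eq_mergeInc (h t : R) {s s' : L.EnhancedState} {i : Fin L.n}
    (hm : L.IsMergeAt s.state i) (hs' : s'.state = Function.update s.state i true) :
    L.incidence R h t s s' = (edgeSign s.state i : R) *
      KhFace.mergeInc R h t (L.circleOf s'.state) s.label s'.label (L.arcIn (L.overPos i))
        (L.arcOut (L.overPos i)) := by
  rw [incidence_of_flip R h t hm.1 hs', if_pos hm, KhFace.mergeInc]
  split_ifs <;> simp

variable {L} in
/-- **Split edges through `KhFaces`.** Along a split edge the incidence number is the Koszul sign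
times the abstract split incidence `KhFace.splitInc` for the circle map of the source state (a
split is never a merge, `IsMergeAt.not_isSplitAt`). Viro (2004), §5.2; Khovanov (2000), Prop. 8.
[cite: Viro2004, §5.2] -/
theorem incidence_eq_splitInc (h t : R) {s s' : L.EnhancedState} {i : Fin L.n}
    (hsp : L.IsSplitAt s.state i) (hs' : s'.state = Function.update s.state i true) :
    L.incidence R h t s s' = (edgeSign s.state i : R) *
      KhFace.splitInc R h t (L.circleOf s.state) s.label s'.label (L.arcIn (L.overPos i))
        (L.arcOut (L.overPos i)) := by
  have hm : ¬ L.IsMergeAt s.state i := fun hm ↦ hm.not_isSplitAt hsp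
  rw [incidence_of_flip R h t hsp.1 hs', if_neg hm, if_pos hsp, KhFace.splitInc]
  split_ifs <;> simp

variable {L R} in
/-- A nonzero incidence number `⟨d s, s'⟩` raises the homological degree by one.
Bar-Natan (2002), §3.2. [cite: BarNatan2002, §3.2] -/
theorem homDegree_eq_of_incidence_ne_zero {h t : R} {s s' : L.EnhancedState}
    (h0 : L.incidence R h t s s' ≠ 0) : homDegree s' = homDegree s + 1 := by
  by_cases hi : ∃ i, s.state i = false ∧ s'.state = Function.update s.state i true
  · obtain ⟨i, hi0, hs'⟩ := hi
    simp only [homDegree, hs', State.weight_update hi0]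
    push_cast
    ring
  · exact (h0 (incidence_of_not_flip R h t hi)).elim

/-- The enhanced states of homological degree `i` (a finite type with decidable equality): the
basis of the `i`-th cochain group. Bar-Natan (2002), §3.2. [cite: BarNatan2002, §3.2] -/
abbrev degStates (i : ℤ) : Type := {s : L.EnhancedState // homDegree s = i}

/-- The enhanced states of bidegree `(i, j)` (homological degree `i`, quantum degree `j`): the
basis of the bigraded cochain group `C^{i,j}`. Bar-Natan (2002), §3.2. [cite: BarNatan2002, §3.2] -/
abbrev bidegStates (i j : ℤ) : Type := {s : L.EnhancedState // homDegree s = i ∧ qDegree s = j}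

/-- The **Khovanov differential** over `A = R[X]/(X² - hX - t)` from homological degree `i` to
degree `i'`: the incidence matrix `(⟨d s, s'⟩)_{s', s}` between the enhanced states of degrees `i`
and `i'`, as a linear map (`Matrix.toLin'`) `(degStates i → R) →ₗ (degStates i' → R)`, verbatim
`GaussDiagram.khovanovD`; it is the differential for `i' = i + 1` and zero otherwise
(`khovanovD_eq_zero_of_ne`). Khovanov (2000), §4.2; Bar-Natan (2002), §3.2; Viro (2004), §5.2;
Khovanov (2006), §2. [cite: Khovanov2000, §4.2] -/
def khovanovD (h t : R) (i i' : ℤ) : (L.degStates i → R) →ₗ[R] (L.degStates i' → R) :=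
  Matrix.toLin' (Matrix.of fun (s' : L.degStates i') (s : L.degStates i) ↦
    L.incidence R h t s.1 s'.1)

/-- The incidence matrix between degrees `i` and `i' ≠ i + 1` vanishes (a nonzero incidence number
raises the homological degree by exactly one). Bar-Natan (2002), §3.2. [cite: BarNatan2002, §3.2] -/
theorem khovanovD_eq_zero_of_ne (h t : R) {i i' : ℤ} (hi : i' ≠ i + 1) :
    L.khovanovD R h t i i' = 0 := by
  have h0 : (Matrix.of fun (s' : L.degStates i') (s : L.degStates i) ↦
      L.incidence R h t s.1 s'.1) = 0 := by
    ext s' s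
    by_contra hne
    exact hi (by rw [← s'.2, ← s.2, homDegree_eq_of_incidence_ne_zero hne])
  rw [khovanovD, h0, map_zero]

/-- The **homology** of the Khovanov complex over `A = R[X]/(X² - hX - t)` in homological degree
`i`, as the concrete subquotient `ker dᵢ ⧸ (im dᵢ₋₁ ⊓ ker dᵢ)` (the range of `dᵢ₋₁` pulled back
along the inclusion of `ker dᵢ`), verbatim `GaussDiagram.frobeniusHomology`: total, and the honest
homology whenever `d² = 0`. For `(h, t) = (0, 0), (0, 1), (1, 0)` this is Khovanov, Lee, Bar-Natan
homology of the link diagram (unnormalised in `q`). Khovanov (2000), §7; Khovanov (2006), §2;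
Bar-Natan (2002), §3.2. [cite: Khovanov2000, §7] -/
def frobeniusHomology (h t : R) (i : ℤ) : ModuleCat R :=
  ModuleCat.of R
    (↥(LinearMap.ker (L.khovanovD R h t i (i + 1))) ⧸
      (LinearMap.range (L.khovanovD R h t (i - 1) i)).comap
        (LinearMap.ker (L.khovanovD R h t i (i + 1))).subtype)

/-- The **Khovanov cochain complex** of a link Gauss diagram over `A = R[X]/(X² - hX - t)`, as a
`CochainComplex (ModuleCat R) ℤ` (`CochainComplex.of`: `i`-th group `degStates i → R`,
differential `khovanovD R h t i (i + 1)`). As in the knot tower (`GaussDiagram.frobeniusComplex`,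
whose hypothesis `hd` is the named fact `khovanovD_comp_khovanovD`), the identity `d² = 0` of THIS
diagram is the explicit hypothesis `hd` (true for diagrams of links in `ℝ³`, Khovanov (2000),
Prop. 8; false for some virtual diagrams over `ℤ`); no named fact is introduced.
Khovanov (2000), §4.2, §7; Khovanov (2006), §2. [cite: Khovanov2000, §7] -/
def frobeniusComplex (h t : R)
    (hd : ∀ i : ℤ, L.khovanovD R h t (i + 1) (i + 1 + 1) ∘ₗ L.khovanovD R h t i (i + 1) = 0) :
    CochainComplex (ModuleCat R) ℤ :=
  CochainComplex.of (fun i ↦ ModuleCat.of R (L.degStates i → R))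
    (fun i ↦ ModuleCat.ofHom (L.khovanovD R h t i (i + 1)))
    (fun i ↦ by rw [← ModuleCat.ofHom_comp, hd i]; rfl)

end Ring

/-! ## Bigraded integral Khovanov homology (`h = t = 0`) -/

/-- The **bigraded integral Khovanov differential** `d : C^{i,j} → C^{i',j}` (`h = t = 0`): the
integral incidence matrix between the enhanced states of bidegrees `(i, j)` and `(i', j)`
(meaningful for `i' = i + 1`), verbatim `GaussDiagram.khovanovDQ`. Khovanov (2000), §4.3;
Bar-Natan (2002), §3.2. [cite: Khovanov2000, §4.3] -/
def khovanovDQ (i i' j : ℤ) : (L.bidegStates i j → ℤ) →ₗ[ℤ] (L.bidegStates i' j → ℤ) :=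
  Matrix.toLin' (Matrix.of fun (s' : L.bidegStates i' j) (s : L.bidegStates i j) ↦
    L.incidence ℤ 0 0 s.1 s'.1)

/-- The **Khovanov homology** `Kh^{i,j}(L)` of a link Gauss diagram in bidegree `(i, j)`, over `ℤ`,
as the concrete subquotient `ker d ⧸ (im d ⊓ ker d)` of the bigraded integral complex at
`h = t = 0`, verbatim `GaussDiagram.khovanovHomology`. Khovanov (2000), §7, Thm. 1;
Bar-Natan (2002), §3.2. [cite: Khovanov2000, §7] -/
def khovanovHomology (i j : ℤ) : ModuleCat ℤ :=
  ModuleCat.of ℤ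
    (↥(LinearMap.ker (L.khovanovDQ i (i + 1) j)) ⧸
      (LinearMap.range (L.khovanovDQ (i - 1) i j)).comap
        (LinearMap.ker (L.khovanovDQ i (i + 1) j)).subtype)

/-! ## Lee's complex and Rasmussen's filtration data (definitions of `LeeRasmussen`, verbatim) -/

/-- **Lee's differential** from homological degree `i` to degree `i'`: the Khovanov differential
over `ℚ[X]/(X² - 1)`, `khovanovD ℚ 0 1 i i'`. Lee (2005), §4; Rasmussen (2010), §2.1.
[cite: Lee2005, §4] -/
abbrev leeD (i i' : ℤ) : (L.degStates i → ℚ) →ₗ[ℚ] (L.degStates i' → ℚ) :=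
  L.khovanovD ℚ 0 1 i i'

/-- **Lee's cochain complex** of a link Gauss diagram, `frobeniusComplex ℚ 0 1 hd` (the `d² = 0`
identity of the diagram is the hypothesis `hd`, as in `frobeniusComplex`). Lee (2005), §4;
Rasmussen (2010), §2.1. [cite: Lee2005, §4] -/
def leeComplex
    (hd : ∀ i : ℤ, L.khovanovD ℚ 0 1 (i + 1) (i + 1 + 1) ∘ₗ L.khovanovD ℚ 0 1 i (i + 1) = 0) :
    CochainComplex (ModuleCat ℚ) ℤ :=
  L.frobeniusComplex ℚ 0 1 hd

/-- **Lee homology** `Kh'^i(L)` in homological degree `i`: `frobeniusHomology ℚ 0 1 i`.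
Lee (2005), §4; Rasmussen (2010), §2.1. [cite: Lee2005, §4] -/
def leeHomology (i : ℤ) : ModuleCat ℚ :=
  L.frobeniusHomology ℚ 0 1 i

/-- The carrier type of **Lee homology in degree zero**, `Kh'^0(L)`:
`↥(ker d₀) ⧸ (range d₋₁).comap (ker d₀).subtype`. Lee (2005), Thm. 4.2; Rasmussen (2010), §2.1.
[cite: Lee2005, §4] -/
abbrev LeeHomologyZero : Type := L.frobeniusHomology ℚ 0 1 0

/-- The **degree-zero Lee cycles** `ker d₀ ≤ (degStates 0 → ℚ)`: literally the submodule whose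
quotient is `LeeHomologyZero L`, so that `Submodule.Quotient.mk : leeCycles L → LeeHomologyZero L`
is the projection to homology. Rasmussen (2010), §2.1, §3.1. [cite: Rasmussen2010, §2] -/
abbrev leeCycles : Submodule ℚ (L.degStates 0 → ℚ) :=
  LinearMap.ker (L.khovanovD ℚ 0 1 0 (0 + 1))

variable {L} in
/-- The **filtration degree** of a degree-zero Lee chain `x`: the least quantum degree of an
enhanced state in the support of `x`, in the complete lattice `WithBot (WithTop ℤ)` (`qMin 0 = ⊤`).
Rasmussen (2010), §2.1–2.2. [cite: Rasmussen2010, §2] -/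
def qMin (x : L.degStates 0 → ℚ) : WithBot (WithTop ℤ) :=
  ⨅ s ∈ {s | x s ≠ 0}, ((qDegree s.1 : WithTop ℤ) : WithBot (WithTop ℤ))

variable {L} in
/-- **Rasmussen's `s(α)`** of a degree-zero Lee homology class: the supremum of the filtration
degrees `qMin z` of the cycles `z` representing `α`. Rasmussen (2010), §2.2, Def. 3.1.
[cite: Rasmussen2010, §2] -/
def classDegree (α : L.LeeHomologyZero) : WithBot (WithTop ℤ) :=
  ⨆ z ∈ {z : L.leeCycles | Submodule.Quotient.mk z = α}, qMin z.1

/-- **`s_min`** of a link Gauss diagram: the least filtration degree of a nonzero degree-zero Lee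
homology class. Rasmussen (2010), Def. 3.1. [cite: Rasmussen2010, §2] -/
def leeSMin : WithBot (WithTop ℤ) :=
  ⨅ α ∈ {α : L.LeeHomologyZero | α ≠ 0}, classDegree α

/-- **`s_max`** of a link Gauss diagram: the greatest filtration degree of a nonzero degree-zero
Lee homology class. Rasmussen (2010), Def. 3.1. [cite: Rasmussen2010, §2] -/
def leeSMax : WithBot (WithTop ℤ) :=
  ⨆ α ∈ {α : L.LeeHomologyZero | α ≠ 0}, classDegree α

/-- **Rasmussen's `s`** of a link Gauss diagram: `s = s_max - 1`, with the knot tower's junk-value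
conventions `⊥ ↦ ⊤ ↦ 0` (`WithBot.unbotD`, `WithTop.untopD`). For the crossingless unknot
`unknots 1`, `s = 0` (`rasmussenInvariant_unknots_one`). Rasmussen (2010), Def. 3.4.
[cite: Rasmussen2010, §2] -/
def rasmussenInvariant : ℤ :=
  ((L.leeSMax.unbotD ⊤).untopD 0) - 1

/-! ## Transport of the concrete homology along intertwining isomorphisms -/

section Transport

variable {R : Type} [CommRing R] {A B C A' B' C' : Type*} [AddCommGroup A] [Module R A]
  [AddCommGroup B] [Module R B] [AddCommGroup C] [Module R C] [AddCommGroup A'] [Module R A']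
  [AddCommGroup B'] [Module R B'] [AddCommGroup C'] [Module R C']

/-- **Transport of the subquotient `ker g ⧸ (im f ⊓ ker g)`** (the concrete homology of
`frobeniusHomology`, `khovanovHomology`) along linear isomorphisms `α, β, γ` intertwining two
composable pairs: `f' ∘ α = β ∘ f` and `g' ∘ β = γ ∘ g` give
`ker g ⧸ (im f ⊓ ker g) ≃ₗ ker g' ⧸ (im f' ⊓ ker g')` (`β` carries `ker g` onto `ker g'` and `im f`
onto `im f'`). No `g ∘ f = 0` is needed. [folklore] -/
def subquotientEquivOfConj (f : A →ₗ[R] B) (g : B →ₗ[R] C) (f' : A' →ₗ[R] B') (g' : B' →ₗ[R] C')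
    (α : A ≃ₗ[R] A') (β : B ≃ₗ[R] B') (γ : C ≃ₗ[R] C')
    (h₁ : f' ∘ₗ α.toLinearMap = β.toLinearMap ∘ₗ f)
    (h₂ : g' ∘ₗ β.toLinearMap = γ.toLinearMap ∘ₗ g) :
    (↥(LinearMap.ker g) ⧸ (LinearMap.range f).comap (LinearMap.ker g).subtype) ≃ₗ[R]
      (↥(LinearMap.ker g') ⧸ (LinearMap.range f').comap (LinearMap.ker g').subtype) :=
  have hker : (LinearMap.ker g).map β.toLinearMap = LinearMap.ker g' := by
    rw [← Submodule.map_comap_eq_of_surjective β.surjective (LinearMap.ker g'),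
      ← LinearMap.ker_comp, h₂, LinearMap.ker_comp, LinearEquiv.ker, Submodule.comap_bot]
  Submodule.Quotient.equiv _ _ (β.ofSubmodules _ _ hker) (by
    ext y
    simp only [Submodule.mem_map, Submodule.mem_comap, LinearMap.mem_range,
      Submodule.subtype_apply]
    constructor
    · rintro ⟨z, ⟨w, hw⟩, rfl⟩
      refine ⟨α w, ?_⟩
      rw [LinearEquiv.coe_coe, LinearEquiv.ofSubmodules_apply, ← hw]
      exact LinearMap.congr_fun h₁ w
    · rintro ⟨w, hw⟩
      refine ⟨(β.ofSubmodules _ _ hker).symm y, ⟨α.symm w, ?_⟩, by simp⟩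
      rw [LinearEquiv.ofSubmodules_symm_apply]
      apply β.injective
      rw [LinearEquiv.apply_symm_apply, ← hw]
      have := LinearMap.congr_fun h₁ (α.symm w)
      simpa using this.symm)

end Transport

/-! ## Agreement with the knot tower on `ofGaussDiagram G`, `G.n ≠ 0` -/

section Correspondence

variable (G : GaussDiagram) (hG : G.n ≠ 0)

/-- `arcEquiv` backwards on the arc entering `p`. [folklore] -/
@[simp]
theorem arcEquiv_symm_arcIn (p : Fin (2 * G.n)) :
    (arcEquiv G hG).symm (G.arcIn p) = (ofGaussDiagram G).arcIn p :=
  (arcEquiv G hG).injective (by simp)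

/-- `arcEquiv` backwards on the arc leaving `p`. [folklore] -/
@[simp]
theorem arcEquiv_symm_arcOut (p : Fin (2 * G.n)) :
    (arcEquiv G hG).symm (G.arcOut p) = (ofGaussDiagram G).arcOut p :=
  (arcEquiv G hG).injective (by simp)

/-- **Transport of an enhanced state of `ofGaussDiagram G` to `G`**: same state, labels transported
along `arcEquiv` (constant on circles since the state graphs are isomorphic, `stateGraphIso`).
Viro (2004), §5. [cite: Viro2004, §5] -/
def EnhancedState.toKnot (s : (ofGaussDiagram G).EnhancedState) : G.EnhancedState where
  state := s.state
  label a := s.label ((arcEquiv G hG).symm a)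
  label_eq _ _ hab := s.label_eq _ _ ((stateGraphIso G hG s.state).symm.map_adj_iff.2 hab)

/-- **Transport of an enhanced state of `G` to `ofGaussDiagram G`**: same state, labels pulled back
along `arcEquiv`. Viro (2004), §5. [cite: Viro2004, §5] -/
def EnhancedState.ofKnot (s : G.EnhancedState) : (ofGaussDiagram G).EnhancedState where
  state := s.state
  label a := s.label (arcEquiv G hG a)
  label_eq _ _ hab := s.label_eq _ _ ((stateGraphIso G hG s.state).map_adj_iff.2 hab)

/-- **Enhanced states correspond**: for `G.n ≠ 0` the enhanced states of `ofGaussDiagram G` and of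
`G` are in canonical bijection (same states, labels transported along `arcEquiv`). Khovanov (2000),
§4.2; Viro (2004), §5. [cite: Viro2004, §5] -/
def enhancedStateEquiv : (ofGaussDiagram G).EnhancedState ≃ G.EnhancedState where
  toFun := EnhancedState.toKnot G hG
  invFun := EnhancedState.ofKnot G hG
  left_inv s := EnhancedState.ext' rfl (funext fun a ↦ by
    simp [EnhancedState.toKnot, EnhancedState.ofKnot])
  right_inv s := by
    cases s
    simp [EnhancedState.toKnot, EnhancedState.ofKnot]

/-- The transported enhanced state has the same underlying state. [folklore] -/
@[simp]
theorem enhancedStateEquiv_state (s : (ofGaussDiagram G).EnhancedState) :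
    (enhancedStateEquiv G hG s).state = s.state := rfl

/-- The transported enhanced state has the transported labels. [folklore] -/
@[simp]
theorem enhancedStateEquiv_label (s : (ofGaussDiagram G).EnhancedState) (a : G.Arc) :
    (enhancedStateEquiv G hG s).label a = s.label ((arcEquiv G hG).symm a) := rfl

/-- **Homological degrees correspond** (same state, same `n₋`: definitional). Bar-Natan (2002),
§3.2. [cite: BarNatan2002, §3.2] -/
theorem homDegree_enhancedStateEquiv (s : (ofGaussDiagram G).EnhancedState) :
    GaussDiagram.homDegree (enhancedStateEquiv G hG s) = homDegree s := rfl

/-- The circles of `ofGaussDiagram G` carrying an arc with a given label correspond, under the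
bijection of state circles induced by `stateGraphIso`, to the circles of `G` carrying an arc with
that (transported) label; in particular they are equinumerous. [folklore] -/
theorem card_filter_circle_enhancedStateEquiv (s : (ofGaussDiagram G).EnhancedState) (b : Bool) :
    (Finset.univ.filter fun c : G.StateCircle (enhancedStateEquiv G hG s).state ↦
        ∃ a, G.circleOf (enhancedStateEquiv G hG s).state a = c ∧
          (enhancedStateEquiv G hG s).label a = b).card =
      (Finset.univ.filter fun c : (ofGaussDiagram G).StateCircle s.state ↦
        ∃ a, (ofGaussDiagram G).circleOf s.state a = c ∧ s.label a = b).card := by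
  change (Finset.univ.filter fun c : G.StateCircle s.state ↦
      ∃ a, G.circleOf s.state a = c ∧ s.label ((arcEquiv G hG).symm a) = b).card = _
  symm
  refine Finset.card_equiv (stateGraphIso G hG s.state).connectedComponentEquiv fun c ↦ ?_
  simp only [Finset.mem_filter, Finset.mem_univ, true_and]
  constructor
  · rintro ⟨a, rfl, ha⟩
    exact ⟨arcEquiv G hG a, by simp [circleOf, GaussDiagram.circleOf, stateGraphIso],
      by simpa using ha⟩
  · rintro ⟨a, ha, hl⟩
    refine ⟨(arcEquiv G hG).symm a, ?_, hl⟩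
    apply (stateGraphIso G hG s.state).connectedComponentEquiv.injective
    rw [← ha]
    simp [circleOf, GaussDiagram.circleOf, stateGraphIso]

/-- **Quantum degrees correspond**: state circles correspond (`stateGraphIso`), with their labels,
and `|s|`, `n₊`, `n₋` are those of `G`. Bar-Natan (2002), §3.2. [cite: BarNatan2002, §3.2] -/
theorem qDegree_enhancedStateEquiv (s : (ofGaussDiagram G).EnhancedState) :
    GaussDiagram.qDegree (enhancedStateEquiv G hG s) = qDegree s := by
  unfold GaussDiagram.qDegree qDegree
  rw [card_filter_circle_enhancedStateEquiv G hG s false,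
    card_filter_circle_enhancedStateEquiv G hG s true]
  rfl

/-- The agreement clause of the incidence number (labels agree off the circle of `arcIn p`)
corresponds under `arcEquiv` (circles correspond, `circleOf_ofGaussDiagram_eq_iff`). [folklore] -/
theorem forall_circleOf_ne_imp_iff (τ : G.State) (p : Fin (2 * G.n))
    (f g : (ofGaussDiagram G).Arc → Bool) :
    (∀ c : G.Arc, G.circleOf τ c ≠ G.circleOf τ (G.arcIn p) →
        f ((arcEquiv G hG).symm c) = g ((arcEquiv G hG).symm c)) ↔
      ∀ c, (ofGaussDiagram G).circleOf τ c ≠ (ofGaussDiagram G).circleOf τ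
        ((ofGaussDiagram G).arcIn p) → f c = g c := by
  refine ((arcEquiv G hG).symm.forall_congr fun c ↦ ?_)
  simp only [ne_eq, circleOf_ofGaussDiagram_eq_iff G hG, Equiv.apply_symm_apply, arcEquiv_arcIn]

variable (R : Type) [CommRing R]

/-- **Incidence numbers correspond.** For `G.n ≠ 0` the incidence number of two enhanced states of
`ofGaussDiagram G` equals the knot tower's incidence number of the transported enhanced states of
`G`: the states are the same, merges and splits correspond (`isMergeAt_ofGaussDiagram_iff`,
`isSplitAt_ofGaussDiagram_iff`), the agreement clauses correspond (`forall_circleOf_ne_imp_iff`),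
`arcEquiv` carries the local strands `arcIn/arcOut (overPos i)` to the knot tower's, and the Koszul
signs agree. Viro (2004), §5.2. [cite: Viro2004, §5.2] -/
theorem incidence_enhancedStateEquiv (h t : R) (s s' : (ofGaussDiagram G).EnhancedState) :
    G.incidence R h t (enhancedStateEquiv G hG s) (enhancedStateEquiv G hG s') =
      (ofGaussDiagram G).incidence R h t s s' := by
  by_cases hex : ∃ i, s.state i = false ∧ s'.state = Function.update s.state i true
  · obtain ⟨i, hi, hs'⟩ := hex
    rw [incidence_of_flip R h t hi hs']
    have hexG : ∃ j, (enhancedStateEquiv G hG s).state j = false ∧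
        (enhancedStateEquiv G hG s').state =
          Function.update (enhancedStateEquiv G hG s).state j true := ⟨i, hi, hs'⟩
    unfold GaussDiagram.incidence
    rw [dif_pos hexG]
    have hj : Classical.choose hexG = i :=
      flip_unique (L := ofGaussDiagram G) hi ((Classical.choose_spec hexG).2.symm.trans hs')
    simp only [hj]
    simp only [enhancedStateEquiv_state, enhancedStateEquiv_label,
      isMergeAt_ofGaussDiagram_iff G hG, isSplitAt_ofGaussDiagram_iff G hG,
      ← forall_circleOf_ne_imp_iff G hG, arcEquiv_symm_arcIn, arcEquiv_symm_arcOut,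
      ofGaussDiagram_overPos, edgeSign_ofGaussDiagram]
  · rw [incidence_of_not_flip R h t hex]
    unfold GaussDiagram.incidence
    rw [dif_neg]
    exact hex

/-- The same correspondence read from `G`: the knot tower's incidence numbers are those of the
pulled-back enhanced states of `ofGaussDiagram G`. Viro (2004), §5.2. [cite: Viro2004, §5.2] -/
theorem incidence_enhancedStateEquiv_symm (h t : R) (s s' : G.EnhancedState) :
    (ofGaussDiagram G).incidence R h t ((enhancedStateEquiv G hG).symm s)
        ((enhancedStateEquiv G hG).symm s') = G.incidence R h t s s' := by
  rw [← incidence_enhancedStateEquiv G hG, Equiv.apply_symm_apply, Equiv.apply_symm_apply]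

/-- **Degree pieces correspond**: `enhancedStateEquiv` restricts to a bijection between the enhanced
states of homological degree `i` (`homDegree_enhancedStateEquiv`). Bar-Natan (2002), §3.2.
[cite: BarNatan2002, §3.2] -/
def degStatesEquiv (i : ℤ) : (ofGaussDiagram G).degStates i ≃ G.degStates i :=
  (enhancedStateEquiv G hG).subtypeEquiv fun _ ↦ Iff.rfl

/-- **Bidegree pieces correspond** (`homDegree_enhancedStateEquiv`, `qDegree_enhancedStateEquiv`).
Bar-Natan (2002), §3.2. [cite: BarNatan2002, §3.2] -/
def bidegStatesEquiv (i j : ℤ) : (ofGaussDiagram G).bidegStates i j ≃ G.bidegStates i j :=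
  (enhancedStateEquiv G hG).subtypeEquiv fun s ↦ by
    rw [homDegree_enhancedStateEquiv, qDegree_enhancedStateEquiv]

/-- **The differentials correspond.** For `G.n ≠ 0` the Khovanov differential of
`ofGaussDiagram G` is the knot tower's differential of `G` conjugated by the relabelling of the
bases: with `φᵢ := LinearEquiv.funCongrLeft R R (degStatesEquiv G hG i) : (G.degStates i → R) ≃ₗ[R]
((ofGaussDiagram G).degStates i → R)`, `x ↦ x ∘ degStatesEquiv G hG i`, one has
`d_L ∘ φᵢ = φᵢ' ∘ d_G` (entrywise this is `incidence_enhancedStateEquiv`). Khovanov (2000), §4.2;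
Viro (2004), §5.2. [cite: Viro2004, §5.2] -/
theorem khovanovD_comp_funCongrLeft (h t : R) (i i' : ℤ) :
    (ofGaussDiagram G).khovanovD R h t i i' ∘ₗ
        (LinearEquiv.funCongrLeft R R (degStatesEquiv G hG i)).toLinearMap =
      (LinearEquiv.funCongrLeft R R (degStatesEquiv G hG i')).toLinearMap ∘ₗ
        G.khovanovD R h t i i' := by
  refine LinearMap.ext fun x ↦ funext fun s' ↦ ?_
  simp only [khovanovD, GaussDiagram.khovanovD, LinearMap.coe_comp, Function.comp_apply,
    LinearEquiv.coe_coe, LinearEquiv.funCongrLeft_apply, LinearMap.funLeft_apply,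
    Matrix.toLin'_apply, Matrix.mulVec, dotProduct, Matrix.of_apply]
  exact Fintype.sum_equiv (degStatesEquiv G hG i) _ _ fun s ↦ by
    rw [← incidence_enhancedStateEquiv G hG]
    rfl

/-- **The bigraded integral differentials correspond** likewise, along `bidegStatesEquiv`.
Khovanov (2000), §4.3. [cite: Khovanov2000, §4.3] -/
theorem khovanovDQ_comp_funCongrLeft (i i' j : ℤ) :
    (ofGaussDiagram G).khovanovDQ i i' j ∘ₗ
        (LinearEquiv.funCongrLeft ℤ ℤ (bidegStatesEquiv G hG i j)).toLinearMap =
      (LinearEquiv.funCongrLeft ℤ ℤ (bidegStatesEquiv G hG i' j)).toLinearMap ∘ₗ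
        G.khovanovDQ i i' j := by
  refine LinearMap.ext fun x ↦ funext fun s' ↦ ?_
  simp only [khovanovDQ, GaussDiagram.khovanovDQ, LinearMap.coe_comp, Function.comp_apply,
    LinearEquiv.coe_coe, LinearEquiv.funCongrLeft_apply, LinearMap.funLeft_apply,
    Matrix.toLin'_apply, Matrix.mulVec, dotProduct, Matrix.of_apply]
  exact Fintype.sum_equiv (bidegStatesEquiv G hG i j) _ _ fun s ↦ by
    rw [← incidence_enhancedStateEquiv G hG]
    rfl

/-- **Homology corresponds.** For `G.n ≠ 0` the concrete homology `ker dᵢ ⧸ (im dᵢ₋₁ ⊓ ker dᵢ)` of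
`ofGaussDiagram G` over `A = R[X]/(X² - hX - t)` is isomorphic to the knot tower's
`G.frobeniusHomology R h t i` (transport along the intertwining relabellings,
`khovanovD_comp_funCongrLeft`, `subquotientEquivOfConj`; no `d² = 0` needed). Khovanov (2000),
§7; Khovanov (2006), §2. [cite: Khovanov2000, §7] -/
def frobeniusHomologyIso (h t : R) (i : ℤ) :
    (ofGaussDiagram G).frobeniusHomology R h t i ≅ G.frobeniusHomology R h t i :=
  (LinearEquiv.toModuleIso (subquotientEquivOfConj _ _ _ _
    (LinearEquiv.funCongrLeft R R (degStatesEquiv G hG (i - 1)))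
    (LinearEquiv.funCongrLeft R R (degStatesEquiv G hG i))
    (LinearEquiv.funCongrLeft R R (degStatesEquiv G hG (i + 1)))
    (khovanovD_comp_funCongrLeft G hG R h t (i - 1) i)
    (khovanovD_comp_funCongrLeft G hG R h t i (i + 1)))).symm

/-- **Bigraded Khovanov homology corresponds**: `Kh^{i,j}(ofGaussDiagram G) ≅ Kh^{i,j}(G)` for
`G.n ≠ 0` (same transport, `khovanovDQ_comp_funCongrLeft`). Khovanov (2000), §7.
[cite: Khovanov2000, §7] -/
def khovanovHomologyIso (i j : ℤ) :
    (ofGaussDiagram G).khovanovHomology i j ≅ G.khovanovHomology i j :=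
  (LinearEquiv.toModuleIso (subquotientEquivOfConj _ _ _ _
    (LinearEquiv.funCongrLeft ℤ ℤ (bidegStatesEquiv G hG (i - 1) j))
    (LinearEquiv.funCongrLeft ℤ ℤ (bidegStatesEquiv G hG i j))
    (LinearEquiv.funCongrLeft ℤ ℤ (bidegStatesEquiv G hG (i + 1) j))
    (khovanovDQ_comp_funCongrLeft G hG (i - 1) i j)
    (khovanovDQ_comp_funCongrLeft G hG i (i + 1) j))).symm

end Correspondence

/-! ## Sanity: the crossingless unlink diagrams `unknots k` -/

section Unknots

variable (k : ℕ)

/-- `unknots k` has no chord: its chord-index type is empty. [folklore] -/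
instance isEmpty_fin_unknots_n : IsEmpty (Fin (unknots k).n) :=
  ⟨fun i ↦ Nat.not_lt_zero _ i.isLt⟩

/-- `unknots k` has no positive crossing. Bar-Natan (2002), §3.1. [cite: BarNatan2002, §3.1] -/
theorem nPlus_unknots : (unknots k).nPlus = 0 := by
  simp [nPlus]

/-- `unknots k` has no negative crossing. Bar-Natan (2002), §3.1. [cite: BarNatan2002, §3.1] -/
theorem nMinus_unknots : (unknots k).nMinus = 0 := by
  simp [nMinus]

/-- Every state of `unknots k` has weight `0`. Bar-Natan (2002), §3.1. [cite: BarNatan2002, §3.1] -/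
theorem State.weight_unknots (σ : (unknots k).State) : σ.weight = 0 := by
  simp [State.weight]

/-- **Sanity.** Every enhanced state of `unknots k` has homological degree `0`. Bar-Natan (2002),
§3.2 (the unknot and the unlinks). [cite: BarNatan2002, §3.2] -/
theorem homDegree_unknots (s : (unknots k).EnhancedState) : homDegree s = 0 := by
  simp [homDegree, State.weight_unknots, nMinus_unknots]

/-- The state graphs of `unknots k` have no edge (free circles are isolated). [folklore] -/
theorem not_stateGraph_adj_unknots (σ : (unknots k).State) (a b : (unknots k).Arc) :
    ¬ ((unknots k).stateGraph σ).Adj a b := by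
  rcases a with q | j
  · exact (Nat.not_lt_zero _ q.isLt).elim
  · exact (unknots k).not_stateGraph_adj_inr_left σ j b

/-- **Enhanced states of `unknots k` are the labellings of its `k` free circles** (the state is
unique and the constancy condition is empty). Khovanov (2000), §4.2; Bar-Natan (2002), §3.2.
[cite: BarNatan2002, §3.2] -/
def enhancedStateUnknotsEquiv : (unknots k).EnhancedState ≃ ((unknots k).Arc → Bool) where
  toFun s := s.label
  invFun f := ⟨fun _ ↦ false, f, fun a b hab ↦ (not_stateGraph_adj_unknots k _ a b hab).elim⟩
  left_inv _ := EnhancedState.ext' (funext fun i ↦ isEmptyElim i) rfl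
  right_inv _ := rfl

/-- **Sanity.** `unknots k` has exactly `2 ^ k` enhanced states (`k` circles, two labels each):
the cube complex of the `k`-component unlink is `A^{⊗ k}` in degree `0`. Bar-Natan (2002), §3.2;
Khovanov (2000), §4.2. [cite: BarNatan2002, §3.2] -/
theorem card_enhancedState_unknots : Fintype.card (unknots k).EnhancedState = 2 ^ k := by
  rw [Fintype.card_congr (enhancedStateUnknotsEquiv k), Fintype.card_fun, Fintype.card_bool,
    Fintype.card_sum, Fintype.card_fin, Fintype.card_fin]
  show 2 ^ (2 * 0 + k) = 2 ^ k
  rw [Nat.mul_zero, Nat.zero_add]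

/-- The state circles of `unknots k` (in any state) are its `k` free circles: `j ↦` the circle of
the free circle `j` is a bijection (`circleOf_inr_eq_iff`). Khovanov (2000), §4.2.
[cite: Khovanov2000, §4.2] -/
def stateCircleUnknotsEquiv (σ : (unknots k).State) : Fin k ≃ (unknots k).StateCircle σ :=
  Equiv.ofBijective (fun j ↦ (unknots k).circleOf σ (.inr j))
    ⟨fun j j' hjj' ↦ Sum.inr_injective (((unknots k).circleOf_inr_eq_iff σ j _).1 hjj').symm,
      fun c ↦ by
        induction c using SimpleGraph.ConnectedComponent.ind with
        | h a =>
          rcases a with q | j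
          · exact (Nat.not_lt_zero _ q.isLt).elim
          · exact ⟨j, rfl⟩⟩

/-- **Sanity: the quantum degree of a labelling of the unlink** is
`#(circles labelled 1) - #(circles labelled X)` (no crossings: `|s| = n₊ = n₋ = 0`); for
`unknots 1` the two enhanced states sit in `q = ±1`, as the knot tower's `GaussDiagram.empty`.
Bar-Natan (2002), §3.2. [cite: BarNatan2002, §3.2] -/
theorem qDegree_unknots (s : (unknots k).EnhancedState) :
    qDegree s = ((Finset.univ.filter fun j : Fin k ↦ s.label (.inr j) = false).card : ℤ) -
      ((Finset.univ.filter fun j : Fin k ↦ s.label (.inr j) = true).card : ℤ) := by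
  have hc : ∀ b : Bool, (Finset.univ.filter fun c : (unknots k).StateCircle s.state ↦
      ∃ a, (unknots k).circleOf s.state a = c ∧ s.label a = b).card =
      (Finset.univ.filter fun j : Fin k ↦ s.label (.inr j) = b).card := by
    intro b
    symm
    refine Finset.card_equiv (stateCircleUnknotsEquiv k s.state) fun j ↦ ?_
    simp only [Finset.mem_filter, Finset.mem_univ, true_and, stateCircleUnknotsEquiv,
      Equiv.ofBijective_apply]
    constructor
    · exact fun hj ↦ ⟨.inr j, rfl, hj⟩
    · rintro ⟨a, ha, hl⟩
      obtain rfl : a = .inr j := ((unknots k).circleOf_inr_eq_iff s.state j a).1 ha.symm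
      exact hl
  unfold qDegree
  rw [hc false, hc true, State.weight_unknots, nPlus_unknots, nMinus_unknots]
  simp

/-- Quantum degrees of the unlink `unknots k` lie in `[-k, k]`. Bar-Natan (2002), §3.2.
[cite: BarNatan2002, §3.2] -/
theorem abs_qDegree_unknots_le (s : (unknots k).EnhancedState) : |qDegree s| ≤ k := by
  rw [qDegree_unknots, abs_le]
  have h₁ := (Finset.univ.filter fun j : Fin k ↦ s.label (.inr j) = false).card_le_univ
  have h₂ := (Finset.univ.filter fun j : Fin k ↦ s.label (.inr j) = true).card_le_univ
  rw [Fintype.card_fin] at h₁ h₂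
  constructor <;> omega

/-- The enhanced state of `unknots k` with every circle labelled `1`: the top-degree Lee generator
of the unlink (for `k = 1`, the knot tower's `GaussDiagram.oneStateEmpty`). Bar-Natan (2002), §3.2;
Rasmussen (2010), §2.3. [cite: BarNatan2002, §3.2] -/
def oneStateUnknots : (unknots k).EnhancedState :=
  (enhancedStateUnknotsEquiv k).symm fun _ ↦ false

/-- The all-`1` labelling of the unlink has quantum degree `k`. Bar-Natan (2002), §3.2.
[cite: BarNatan2002, §3.2] -/
theorem qDegree_oneStateUnknots : qDegree (oneStateUnknots k) = k := by
  rw [qDegree_unknots]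
  simp [oneStateUnknots, enhancedStateUnknotsEquiv]

/-- `unknots k` has no enhanced state of nonzero homological degree, so all its Khovanov / Lee
differentials vanish. Bar-Natan (2002), §3.2. [cite: BarNatan2002, §3.2] -/
theorem isEmpty_degStates_unknots {i : ℤ} (hi : i ≠ 0) : IsEmpty ((unknots k).degStates i) :=
  ⟨fun s ↦ hi (s.2.symm.trans (homDegree_unknots k s.1))⟩

/-- For `unknots k` the projection from degree-zero Lee cycles to Lee homology is injective (the
incoming differential `d₋₁` has zero domain). Rasmussen (2010), §2.3. [cite: Rasmussen2010, §2] -/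
theorem mk_leeCycles_unknots_eq_zero_iff (z : (unknots k).leeCycles) :
    (Submodule.Quotient.mk z : (unknots k).LeeHomologyZero) = 0 ↔ z = 0 := by
  rw [Submodule.Quotient.mk_eq_zero, Submodule.mem_comap, LinearMap.mem_range]
  haveI : IsEmpty ((unknots k).degStates (0 - 1)) := isEmpty_degStates_unknots k (by decide)
  constructor
  · rintro ⟨y, hy⟩
    rw [Subsingleton.elim y 0, map_zero] at hy
    exact Subtype.ext hy.symm
  · rintro rfl
    exact ⟨0, by rw [map_zero]; rfl⟩

/-- **Sanity: `s_max (unknots k) = k`.** Every nonzero degree-zero Lee cycle of the unlink is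
supported on labellings of quantum degree `≤ k`, and the cycle `[all circles labelled 1]` has
filtration degree exactly `k` and nonzero class (no differentials). For `k = 1` this is the knot
tower's `GaussDiagram.leeSMax_empty = 1`. Rasmussen (2010), §3 (unknot); Lee (2005), §4.
[cite: Rasmussen2010, §2] -/
theorem leeSMax_unknots :
    (unknots k).leeSMax = (((k : ℤ) : WithTop ℤ) : WithBot (WithTop ℤ)) := by
  apply le_antisymm
  · refine iSup₂_le fun α hα ↦ iSup₂_le fun z hz ↦ ?_
    have hz : Submodule.Quotient.mk z = α := hz
    have hz0 : z ≠ 0 := by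
      rintro rfl
      exact hα (hz ▸ (mk_leeCycles_unknots_eq_zero_iff k 0).2 rfl)
    obtain ⟨s, hs⟩ : ∃ s, z.1 s ≠ 0 := by
      by_contra! h
      exact hz0 (Subtype.ext (funext h))
    exact (iInf₂_le s hs).trans (by exact_mod_cast (abs_le.1 (abs_qDegree_unknots_le k s.1)).2)
  · let s0 : (unknots k).degStates 0 := ⟨oneStateUnknots k, homDegree_unknots k _⟩
    have hker : Pi.single s0 (1 : ℚ) ∈ (unknots k).leeCycles := by
      haveI : IsEmpty ((unknots k).degStates (0 + 1)) := isEmpty_degStates_unknots k (by decide)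
      exact Subsingleton.elim _ _
    let z0 : (unknots k).leeCycles := ⟨_, hker⟩
    have hz0 : z0 ≠ 0 := fun h ↦ by
      have := congrArg (fun z : (unknots k).leeCycles ↦ z.1 s0) h
      simp [z0] at this
    refine le_iSup₂_of_le (Submodule.Quotient.mk z0)
      (fun h ↦ hz0 ((mk_leeCycles_unknots_eq_zero_iff k z0).1 h)) (le_iSup₂_of_le z0 rfl ?_)
    refine le_iInf₂ fun s hs ↦ ?_
    have : s = s0 := by
      by_contra hne
      exact hs (Pi.single_eq_of_ne hne _)
    subst this
    exact_mod_cast (qDegree_oneStateUnknots k).ge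

/-- **Sanity: the Rasmussen invariant of the crossingless unknot diagram `unknots 1` is `0`**
(`s = s_max - 1`, `s_max = 1`), as the knot tower's `GaussDiagram.rasmussenInvariant_empty`.
Rasmussen (2010), §3 (the unknot has `s = 0`). [cite: Rasmussen2010, §2] -/
theorem rasmussenInvariant_unknots_one : (unknots 1).rasmussenInvariant = 0 := by
  rw [rasmussenInvariant, leeSMax_unknots]
  rfl

end Unknots

end LinkGaussDiagram

end Literature.Topology.FourManifolds

end
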